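import Literature.NumberTheory.GaloisRepresentations.CentralInvolutionBreakProofs
import HarnessLib

/-!
# The upper filtration from the list of indices: `vol {u > 0 : G^u ≠ 1} = (b + Σ (i_G(s) - 1)) / #G₀`

`Proofs` file (theorems only, no definitions, no named facts) in topic
`NumberTheory/GaloisRepresentations`, landed by the seat of bsd.S15
(`Literature.NumberTheory.EllipticCurves.conductorNorm_eq_artinConductorNat_of_isElliptic`): the
assembly step of the explicit-field route to the wild conductor.  Once the non-trivial elements of
the inertia group `G₀` of a prime `𝔔` are listed by a finset `T` together with their indices
`i_G(s) = f(s)` (certified e.g. by `lowerIndex_eq_ord_smul_sub_of_mem_inertia`,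
`RamificationCertificatesProofs`), the whole filtration is determined:

* `ramificationSubgroup_ne_bot_iff_exists_of_lowerIndex_eq` — `G_i ≠ 1 ↔ ∃ s ∈ T, i + 1 ≤ f(s)`;
* `ramificationSubgroup_ne_bot_iff_le_sup_of_lowerIndex_eq` — for `i ≥ 1` and `T ≠ ∅`:
  `G_i ≠ 1 ↔ i ≤ b` with `b = max_{s ∈ T} f(s) - 1` (the last lower break);
* `volume_real_setOf_upperRamificationSubgroup_ne_bot_eq_of_lowerIndex_eq` —
  **`vol {u > 0 : G^u ≠ 1} = φ(b) = (b + Σ_{s ∈ T} (f(s) - 1)) / (#T + 1)`** (Serre IV §3 Lemma 3,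
  the tree's `card_mul_herbrandPhi_eq_of_lowerIndex_eq` and
  `volume_real_setOf_upperRamificationSubgroup_ne_bot_eq_herbrandPhi`).

## References

* J.-P. Serre, *Local Fields*, GTM 67 (1979), Ch. IV §1 (`i_G`), §3 Lemma 3 and the upper
  numbering (pp. 73–74). [SerreLocalFields1979]

## Design

Theorems only; setting of `CentralInvolutionBreakProofs` (`S` a commutative ring with a
`G`-action, `𝔓` an ideal, `G` finite); `noncomputable section`.  Axioms: `propext`,
`Classical.choice`, `Quot.sound`.
-/

noncomputable section

open scoped Pointwise
open MeasureTheory Set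

namespace Literature.NumberTheory.GaloisRepresentations

variable {S : Type*} [CommRing S] (𝔓 : Ideal S) {G : Type*} [Group G] [MulSemiringAction G S]

/-- **`G_i ≠ 1 ↔ ∃ s ∈ T, i + 1 ≤ f(s)`** when `T` lists the non-trivial elements of `G₀` with
indices `i_G(s) = f(s)`: a non-trivial element of `G_i ≤ G₀` is some `s ∈ T` with `i_G(s) ≥ i + 1`.
[cite: SerreLocalFields1979, Ch. IV §1 (p. 62)] -/
theorem ramificationSubgroup_ne_bot_iff_exists_of_lowerIndex_eq (T : Finset G)
    (hT : ∀ s, s ∈ T ↔ s ∈ 𝔓.ramificationSubgroup G 0 ∧ s ≠ 1) (f : G → ℕ)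
    (hf : ∀ s ∈ T, lowerIndex 𝔓 G s = f s) (i : ℕ) :
    𝔓.ramificationSubgroup G i ≠ ⊥ ↔ ∃ s ∈ T, i + 1 ≤ f s := by
  rw [Subgroup.ne_bot_iff_exists_ne_one]
  constructor
  · rintro ⟨⟨s, hs⟩, hs1⟩
    have hs1' : s ≠ 1 := fun h ↦ hs1 (Subtype.ext h)
    have hs0 : s ∈ 𝔓.ramificationSubgroup G 0 := 𝔓.ramificationSubgroup_antitone G (Nat.zero_le i) hs
    have hsT : s ∈ T := (hT s).mpr ⟨hs0, hs1'⟩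
    refine ⟨s, hsT, ?_⟩
    have := add_one_le_lowerIndex 𝔓 hs
    rw [hf s hsT] at this
    exact_mod_cast this
  · rintro ⟨s, hsT, hle⟩
    have hs1 : s ≠ 1 := ((hT s).mp hsT).2
    have hs : s ∈ 𝔓.ramificationSubgroup G i := by
      rw [← add_one_le_lowerIndex_iff 𝔓, hf s hsT]
      exact_mod_cast hle
    exact ⟨⟨s, hs⟩, fun h ↦ hs1 (congrArg Subtype.val h)⟩

/-- **The last lower break**: for `i ≥ 1` and `T ≠ ∅`, `G_i ≠ 1 ↔ i ≤ b` with
`b = max_{s ∈ T} f(s) - 1`. [cite: SerreLocalFields1979, Ch. IV §1 (p. 62)] -/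
theorem ramificationSubgroup_ne_bot_iff_le_sup_of_lowerIndex_eq (T : Finset G)
    (hT : ∀ s, s ∈ T ↔ s ∈ 𝔓.ramificationSubgroup G 0 ∧ s ≠ 1) (f : G → ℕ)
    (hf : ∀ s ∈ T, lowerIndex 𝔓 G s = f s) (i : ℕ) (hi : 1 ≤ i) :
    𝔓.ramificationSubgroup G i ≠ ⊥ ↔ i ≤ T.sup f - 1 := by
  rw [ramificationSubgroup_ne_bot_iff_exists_of_lowerIndex_eq 𝔓 T hT f hf i]
  constructor
  · rintro ⟨s, hsT, hle⟩
    have := Finset.le_sup (f := f) hsT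
    omega
  · intro hle
    have hpos : 0 < T.sup f := by omega
    obtain ⟨s, hsT, hs⟩ : ∃ s ∈ T, T.sup f = f s := by
      have hne : T.Nonempty := by
        by_contra h
        rw [Finset.not_nonempty_iff_eq_empty] at h
        rw [h, Finset.sup_empty] at hpos
        exact lt_irrefl _ hpos
      exact Finset.exists_mem_eq_sup T hne f
    exact ⟨s, hsT, by omega⟩

variable [Finite G]

/-- **The upper filtration from the indices.**  If `T` lists the non-trivial elements of `G₀`
with indices `i_G(s) = f(s) ≥ 1` and `T ≠ ∅`, then with `b = max f - 1`:
**`vol {u > 0 : G^u ≠ 1} = φ(b) = (b + Σ_{s ∈ T} (f(s) - 1)) / (#T + 1)`** — Serre's Lemma 3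
`#G₀ (φ(b) + 1) = Σ_{s ∈ G₀} min(i_G(s), b + 1)` evaluated, `#G₀ = #T + 1`, and `φ(b)` is the last
upper break.  This is the number the wild conductor of a representation on which every
non-trivial `G_i` acts without fixed points is twice of.
[cite: SerreLocalFields1979, Ch. IV §3 Lemma 3 (p. 74) and pp. 73–74] -/
theorem volume_real_setOf_upperRamificationSubgroup_ne_bot_eq_of_lowerIndex_eq (T : Finset G)
    (hT : ∀ s, s ∈ T ↔ s ∈ 𝔓.ramificationSubgroup G 0 ∧ s ≠ 1) (hTne : T.Nonempty) (f : G → ℕ)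
    (hf : ∀ s ∈ T, lowerIndex 𝔓 G s = f s) :
    volume.real {u : ℝ | 0 < u ∧ upperRamificationSubgroup 𝔓 G u ≠ ⊥} =
      ((T.sup f - 1 : ℕ) + ∑ s ∈ T, ((f s : ℝ) - 1)) / (T.card + 1) := by
  set b : ℕ := T.sup f - 1 with hb
  -- indices are `≥ 1` on `T` (elements of `G₀`), so `max f ≥ 1` and `f s ≤ b + 1`
  have hf1 : ∀ s ∈ T, 1 ≤ f s := by
    intro s hsT
    have hs0 : s ∈ 𝔓.ramificationSubgroup G 0 := ((hT s).mp hsT).1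
    have := (one_le_lowerIndex_iff 𝔓).mpr hs0
    rw [hf s hsT] at this
    exact_mod_cast this
  have hsup1 : 1 ≤ T.sup f := by
    obtain ⟨s, hs⟩ := hTne
    exact le_trans (hf1 s hs) (Finset.le_sup hs)
  have hle : ∀ s ∈ T, f s ≤ b + 1 := by
    intro s hsT
    have := Finset.le_sup (f := f) hsT
    omega
  have hlast : ∀ i, 1 ≤ i → (𝔓.ramificationSubgroup G i ≠ ⊥ ↔ i ≤ b) :=
    fun i hi ↦ ramificationSubgroup_ne_bot_iff_le_sup_of_lowerIndex_eq 𝔓 T hT f hf i hi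
  rw [volume_real_setOf_upperRamificationSubgroup_ne_bot_eq_herbrandPhi 𝔓 hlast]
  have key := card_mul_herbrandPhi_eq_of_lowerIndex_eq 𝔓 T hT f hf hle
  rw [card_ramificationSubgroup_zero_eq_card_add_one 𝔓 T hT] at key
  push_cast at key
  have hpos : (0 : ℝ) < T.card + 1 := by positivity
  field_simp
  linarith

end Literature.NumberTheory.GaloisRepresentations

end
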